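import Summits.CriticalPhenomena.PercolationContinuityZ3.Theorems.Transplant.DecoratedSlabNeg
import Summits.CriticalPhenomena.PercolationContinuityZ3.Theorems.Transplant.PlanarSkeletonCriticalProbLtOne
import Mathlib.Tactic.FinCases
import HarnessLib

/-!
# The x-decorated two-layer slab is a `PlanarSkeletonSign` (tier 3a): `θ(p_c) = 0` on `Cay(ℤ² × ℤ/2; ±e₀, ±e₁, f, ±e₀+f)` CONDITIONALLY on the
# D″ v2 node `SamePDropOfSkeletonSign` — the lane's smallest new member of the `(ℤ/2)²` class (P5-SHARPNESS row 30; DPRIME-SCOPE §4; DP2 pin)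

builds on p205010 (kernel theorem, internal audit signed; external expert review pending) — nothing in this file uses p205010 (the node is an OPEN
`Prop`, taken as a hypothesis).
Lane `prim-bschramm`, seat `prim-bschramm-p5` (gen 6; refuter — the instance pin DP2 of HOME/prim-bschramm-p5-g6/DPRIME-CHECKLIST.md), helper file
(`--supports stmt-CriticalPhenomena-4575`).  NEW FILE over p4-g6's `DecoratedSlabNeg` (`dsGraph`, `dsSkeletonNeg` with `φ = Prod.fst`, central inversion
`dsNeg`, Φ2 at every density `dsSkeletonNeg_cylSubcritical`, `not_exists_swap`, `decoratedSlab_criticalContinuity_of_negNode`).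
The `(ℤ/2)²` node asks for ONE more automorphism fixing `0` and reversing the second skeleton coordinate: on the abelian carrier `ℤ² × ℤ/2` the
coordinate flip `(x₀, x₁, r) ↦ (x₀, −x₁, r)` is additive and preserves the generating set (`±e₁ ↦ ∓e₁`, the rest fixed), hence an automorphism
(`dsFlipY`).  So:
* `dsFlip`, `dsFlip_mem`, `dsFlipY : dsGraph ≃g dsGraph`, `fst_dsFlipY`;
* **`dsSkeletonSign : PlanarSkeletonSign dsGraph`**; Φ2 `dsSkeletonSign_cylSubcritical` (every density; finite cylinders);
* **`decoratedSlab_criticalContinuity_of_signNode : SamePDropOfSkeletonSign → θ_{dsGraph}(0, p_c) = 0`** (+ `'` every vertex) via the minimal form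
  `samePDropOfSkeletonSign_iff_minimal'` (p248305: no other binder), `decoratedSlab_sign_hypotheses`.
With `DecoratedSlab.isEmpty_planarSkeletonConc` (p239737) this graph is D″-only: unreachable by the node of record through ANY skeleton, reachable by
`SamePDropOfSkeletonSign` through this instance.  Not in print (DCST 2016 needs the π/2-rotation; P5-SHARPNESS §22.1/§22.8).
[cite: BenjaminiSchramm1996, Conj. 4] [cite: KozmaNitzan2024, §4 Lemma 8 p. 16 (the lattice symmetries)] [cite: DuminilCopinSidoraviciusTassion2016, §1 Thm. 2]
-/

noncomputable section

namespace Summit.CriticalPhenomena.PercolationContinuityZ3.Theorems.Transplant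

namespace DecoratedSlab

open MeasureTheory Literature.Probability.Percolation Literature.Probability.LatticeModels SimpleGraph
open scoped Classical

/-! ## §1 The flip of the second coordinate -/

/-- `(y, r) ↦ (flipSnd y, r)`: reverse the second planar coordinate, keep the layer. [this work] -/
def dsFlip (w : DS) : DS := (flipSnd w.1, w.2)

/-- `dsFlip` is an involution. [folklore] -/
@[simp] theorem dsFlip_dsFlip (w : DS) : dsFlip (dsFlip w) = w := by
  simp [dsFlip]

/-- `dsFlip` is additive. [folklore] -/
theorem dsFlip_sub (u w : DS) : dsFlip (w - u) = dsFlip w - dsFlip u := by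
  ext i
  · fin_cases i
    · simp [dsFlip, flipSnd]
    · simp [dsFlip, flipSnd]; ring
  · simp [dsFlip]

/-- `dsFlip` preserves the generating set (`±e₁ ↦ ∓e₁`, the other generators are fixed). [this work] -/
theorem dsFlip_mem {s : DS} (hs : s ∈ dsGens) : dsFlip s ∈ dsGens := by
  rw [mem_dsGens_iff] at hs ⊢
  have h0 : flipSnd (ev 0) = ev 0 := by funext i; fin_cases i <;> simp [flipSnd, ev]
  have h0' : flipSnd (-ev 0) = -ev 0 := by funext i; fin_cases i <;> simp [flipSnd, ev]
  have h1 : flipSnd (ev 1) = -ev 1 := by funext i; fin_cases i <;> simp [flipSnd, ev]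
  have h1' : flipSnd (-ev 1) = ev 1 := by funext i; fin_cases i <;> simp [flipSnd, ev]
  have hz : flipSnd (0 : Site 2) = 0 := by funext i; fin_cases i <;> simp [flipSnd]
  rcases hs with rfl | rfl | rfl | rfl | rfl | rfl | rfl
  · exact Or.inl (by simp [dsFlip, h0])
  · exact Or.inr (Or.inl (by simp [dsFlip, h0']))
  · exact Or.inr (Or.inr (Or.inr (Or.inl (by simp [dsFlip, h1]))))
  · exact Or.inr (Or.inr (Or.inl (by simp [dsFlip, h1'])))
  · exact Or.inr (Or.inr (Or.inr (Or.inr (Or.inl (by simp [dsFlip, hz])))))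
  · refine Or.inr (Or.inr (Or.inr (Or.inr (Or.inr (Or.inl ?_)))))
    ext i
    · fin_cases i <;> simp [dsFlip, flipSnd, ev]
    · simp [dsFlip]
  · refine Or.inr (Or.inr (Or.inr (Or.inr (Or.inr (Or.inr ?_)))))
    ext i
    · fin_cases i <;> simp [dsFlip, flipSnd, ev]
    · simp [dsFlip]

/-- **The flip of the second coordinate is an automorphism of the decorated slab.** [cite: KozmaNitzan2024, §4 Lemma 8 p. 16] -/
def dsFlipY : dsGraph ≃g dsGraph where
  toFun := dsFlip
  invFun := dsFlip
  left_inv := dsFlip_dsFlip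
  right_inv := dsFlip_dsFlip
  map_rel_iff' := by
    intro x y
    show dsGraph.Adj (dsFlip x) (dsFlip y) ↔ dsGraph.Adj x y
    rw [dsGraph_adj_iff, dsGraph_adj_iff, ← dsFlip_sub]
    refine ⟨fun h => ?_, dsFlip_mem⟩
    have := dsFlip_mem h
    rwa [dsFlip_dsFlip] at this

/-- `dsFlipY` acts by `dsFlip`. [folklore] -/
@[simp] theorem dsFlipY_apply (w : DS) : dsFlipY w = dsFlip w := rfl

/-- The planar part of `dsFlipY w` is `flipSnd w.1`. [folklore] -/
@[simp] theorem fst_dsFlip (w : DS) : (dsFlip w).1 = flipSnd w.1 := rfl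

/-! ## §2 The `PlanarSkeletonSign` instance and Φ2 -/

/-- **The decorated slab carries a `PlanarSkeletonSign`**: p4-g6's `dsSkeletonNeg` plus the flip `dsFlipY` at the base vertex `0`.
[cite: KozmaNitzan2024, §4 Lemma 8 p. 16] -/
def dsSkeletonSign : PlanarSkeletonSign dsGraph where
  toPlanarSkeletonNeg := dsSkeletonNeg
  flip := fun t ht => by
    rw [dsSkeletonNeg_types, Finset.mem_singleton] at ht
    subst ht
    refine ⟨dsFlipY, by ext i <;> simp [dsFlip, flipSnd], fun w => ?_⟩
    show (dsFlip w).1 - (0 : DS).1 = flipSnd (w.1 - (0 : DS).1)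
    simp

/-- The base vertices: `{0}`. [folklore] -/
@[simp] theorem dsSkeletonSign_types : dsSkeletonSign.types = {0} := rfl

/-- **Φ2 at every density** (the cylinders are those of `dsSkeletonNeg`: finite). [folklore] -/
theorem dsSkeletonSign_cylSubcritical (p : unitInterval) : dsSkeletonSign.CylSubcritical p :=
  dsSkeletonNeg_cylSubcritical p

/-! ## §3 `θ(p_c) = 0` on the decorated slab from the D″ v2 node -/

/-- **Benjamini–Schramm Conj. 4 for the x-decorated slab, CONDITIONAL ON THE D″ v2 NODE** — through the minimal form (no connectedness,
quasi-transitivity, `p_c < 1` or uniqueness input). [cite: BenjaminiSchramm1996, Conj. 4] [cite: DuminilCopinSidoraviciusTassion2016, §1 Thm. 2] -/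
theorem decoratedSlab_criticalContinuity_of_signNode (hD : SamePDropOfSkeletonSign) :
    theta dsGraph (0 : DS) (criticalProbIOf dsGraph (0 : DS)) = 0 :=
  samePDropOfSkeletonSign_iff_minimal'.1 hD dsGraph dsSkeletonSign 0 (by simp) (dsSkeletonSign_cylSubcritical _)

/-- … at every vertex (vertex-transitivity). [cite: BenjaminiSchramm1996, Conj. 4] -/
theorem decoratedSlab_criticalContinuity_of_signNode' (hD : SamePDropOfSkeletonSign) (v : DS) :
    theta dsGraph v (criticalProbIOf dsGraph v) = 0 := by
  have hθ := theta_iso (dsShift v) 0 (criticalProbIOf dsGraph (0 : DS))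
  have hpc := criticalProb_iso (dsShift v) (0 : DS)
  have hv : dsShift v 0 = v := by simp
  rw [hv] at hθ hpc
  have e : criticalProbIOf dsGraph v = criticalProbIOf dsGraph (0 : DS) := Subtype.ext hpc
  rw [e, hθ]
  exact decoratedSlab_criticalContinuity_of_signNode hD

/-- **What the D″ v2 node is asked to supply for the decorated slab, and nothing else**: the `PlanarSkeletonSign` exists (this file) and Φ2 holds
at every density; `p_c ≤ ½` is automatic. [cite: BenjaminiSchramm1996, Conj. 4] -/
theorem decoratedSlab_sign_hypotheses :
    Nonempty (PlanarSkeletonSign dsGraph) ∧ (∀ p, dsSkeletonSign.CylSubcritical p) ∧ criticalProb dsGraph (0 : DS) ≤ 1 / 2 :=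
  ⟨⟨dsSkeletonSign⟩, dsSkeletonSign_cylSubcritical, dsSkeletonSign.toPlanarSkeletonNeg.criticalProb_le_half 0⟩

end DecoratedSlab

end Summit.CriticalPhenomena.PercolationContinuityZ3.Theorems.Transplant

end
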